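import Literature.NumberTheory.DiophantineGeometry.MultiplicativeGroupApproximationMinkowskiProofs
import Mathlib.LinearAlgebra.LinearIndependent.BaseChange
import HarnessLib

/-!
# Evertse–Győry, Proposition 4.3.4 (geometry of numbers), proved for `ℤ^q`

Topic `NumberTheory/DiophantineGeometry`; namespace
`Literature.NumberTheory.DiophantineGeometry.Dioph`.
Third instalment of the geometry of numbers behind Evertse–Győry, *Unit Equations in
Diophantine Number Theory* (2015), §4.3.1 (see `MultiplicativeGroupApproximationLatticeProofs`
— Lemmas 4.3.5 (BFRT) and 4.3.6 — and `MultiplicativeGroupApproximationMinkowskiProofs` —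
Minkowski's second theorem, Thm 4.3.1).

* `exists_int_basis_le_of_directional` — a basis theorem in the spirit of **Mahler's theorem
  (Evertse–Győry, Thm 4.3.3)**: from a directional system `v₀, …, v_{q−1}` of `ℤ^q` (linearly
  independent, norms non-decreasing) one obtains a `ℤ`-basis `y₀, …, y_{q−1}` of `ℤ^q` with
  `N(y_j) ≤ (j+1) N(v_j)` (the book's sharper `max(1, (j+1)/2)` is not needed below; the proof is
  the classical one: `y_j` has minimal positive `v_j`-coordinate in `ℤ^q ∩ span(v₀, …, v_j)`,
  reduced modulo `v₀, …, v_{j−1}`);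
* `prod_seminorm_le_of_minimal` — the simplified **Lemma 4.3.7**: for a basis `y` whose first
  vector is a shortest non-zero integer vector and a system `a₁, …, a_m` of non-zero generators
  of `ℤ^q` with minimal `∏ N(aᵢ)`, every `q` of the `aᵢ` satisfy `∏ N(a_{i_k}) ≤ ∏ N(y_j)`;
* `evertseGyory_prop_4_3_4_int` — **Proposition 4.3.4** for `V = ℝ^q`, `L = ℤ^q` (the case the
  book reduces to on p. 71): for a norm `N` on `ℝ^q` with `N ≥ θ > 0` on `ℤ^q ∖ {0}`, `m ≥ q`,
  and non-zero `a₁, …, a_m ∈ ℤ^q` generating `ℤ^q` with `∏ N(aᵢ)` minimal among such systems,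
  every `x ∈ ℤ^q` is `∑ bᵢ aᵢ` with `|bᵢ| ≤ q^{2q} N(x)/θ`. Proof as printed (pp. 72–73) with the
  chain `|det| ≤ (q!/2^q) V ∏ N(a_{i_k}) ≤ (q!/2^q) V ∏ N(y_j) ≤ (q!/2^q) · q! · 2^q = (q!)² ≤ q^{2q}`
  (Lemma 4.3.6, Lemma 4.3.7, Mahler + Minkowski), then BFRT (Lemma 4.3.5);
* `exists_repr_le_of_minimal` — the same for a lattice spanned by integer vectors `aᵢ ∈ ℤ^P ⊂ ℝ^P`
  (the form used by Prop 4.4.1 for `K = ℚ`), with the bound written through `m = #κ ≥ rank`: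
  `|bᵢ| ≤ m^{2m} N(x)/θ`. The lattice is free with a `ℤ`-basis of integer vectors, which is
  `ℝ`-linearly independent (Mathlib's `linearIndependent_algebraMap_comp_iff`), so coordinates
  reduce to `evertseGyory_prop_4_3_4_int`.

## References

* [EvertseGyory2015] J.-H. Evertse, K. Győry, *Unit Equations in Diophantine Number Theory*,
  Cambridge Stud. Adv. Math. 146, CUP 2015 — Thm 4.3.3 (p. 70), Prop 4.3.4 (p. 71), Lemma 4.3.7
  and the proof of Prop 4.3.4 (pp. 72–73).
-/

noncomputable section

open MeasureTheory Real Finset Module Set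
open scoped Matrix

namespace Literature.NumberTheory.DiophantineGeometry.Dioph

variable {q : ℕ}

/-! ### A Mahler-type basis of `ℤ^q` from a directional system -/

/-- **Mahler-type basis theorem** (cf. Evertse–Győry, Thm 4.3.3; Cassels, *Geometry of Numbers*,
Ch. V). Let `N` be a seminorm on `ℝ^q` and `v₀, …, v_{q−1} ∈ ℤ^q` linearly independent over `ℝ`
with `N(v₀) ≤ ⋯ ≤ N(v_{q−1})`. Then `ℤ^q` has a `ℤ`-basis `y₀, …, y_{q−1}` (a generating system
of `q` non-zero vectors) with `N(y_j) ≤ (j+1) · N(v_j)`; in particular `N(y₀) ≤ N(v₀)`.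
(The book's version has `max(1, (j+1)/2)` in place of `j+1`.) Construction: `y_j` is a vector
of `ℤ^q ∩ span_ℝ(v₀,…,v_j)` with least positive `v_j`-coordinate, reduced so that its
`vᵢ`-coordinates (`i < j`) lie in `[0,1)`. [cite: EvertseGyory2015, Thm 4.3.3 (p. 70)] -/
theorem exists_int_basis_le_of_directional (N : Seminorm ℝ (Fin q → ℝ))
    (v : Fin q → Fin q → ℤ) (hli : LinearIndependent ℝ (fun k i => (v k i : ℝ)))
    (hmono : Monotone (fun k => N (fun i => (v k i : ℝ)))) :
    ∃ y : Fin q → Fin q → ℤ, Submodule.span ℤ (Set.range y) = ⊤ ∧ (∀ j, y j ≠ 0) ∧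
      ∀ j : Fin q, N (fun i => (y j i : ℝ)) ≤ ((j : ℕ) + 1) * N (fun i => (v j i : ℝ)) := by
  classical
  -- the degenerate case `q = 0`
  rcases Nat.eq_zero_or_pos q with hq | hq
  · subst hq
    refine ⟨v, ?_, fun j => Fin.elim0 j, fun j => Fin.elim0 j⟩
    refine Submodule.eq_top_iff'.mpr fun w => ?_
    have : w = 0 := Subsingleton.elim _ _
    rw [this]; exact Submodule.zero_mem _
  haveI : Nonempty (Fin q) := ⟨⟨0, hq⟩⟩
  -- notation
  set V : Fin q → Fin q → ℝ := fun k i => (v k i : ℝ) with hV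
  let cast : (Fin q → ℤ) → (Fin q → ℝ) := fun z i => (z i : ℝ)
  have cast_sub : ∀ w w' : Fin q → ℤ, cast (w - w') = cast w - cast w' := by
    intro w w'; ext i; simp [cast]
  have cast_zsmul : ∀ (t : ℤ) (w : Fin q → ℤ), cast (t • w) = (t : ℝ) • cast w := by
    intro t w; ext i; simp [cast]
  have cast_v : ∀ k, cast (v k) = V k := fun k => rfl
  have cast_inj : ∀ w w' : Fin q → ℤ, cast w = cast w' → w = w' := by
    intro w w' h; ext i
    have := congrFun h i
    simp only [cast] at this
    exact_mod_cast this
  -- the basis `V` of `ℝ^q` and its coordinate functionals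
  have hcard : Fintype.card (Fin q) = finrank ℝ (Fin q → ℝ) := by simp
  let bV : Basis (Fin q) ℝ (Fin q → ℝ) := basisOfLinearIndependentOfCardEqFinrank hli hcard
  have bV_apply : ∀ k, bV k = V k := fun k => by
    show basisOfLinearIndependentOfCardEqFinrank hli hcard k = V k
    rw [coe_basisOfLinearIndependentOfCardEqFinrank]
  let c : (Fin q → ℝ) → Fin q → ℝ := fun w => bV.repr w
  have c_add : ∀ w w', c (w + w') = c w + c w' := by
    intro w w'; ext i; simp [c]
  have c_sub : ∀ w w', c (w - w') = c w - c w' := by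
    intro w w'; ext i; simp [c]
  have c_smul : ∀ (t : ℝ) w, c (t • w) = t • c w := by
    intro t w; ext i; simp [c]
  have c_V : ∀ k, c (V k) = Pi.single k 1 := by
    intro k
    ext i
    rw [← bV_apply]
    simp [c, Finsupp.single_apply, Pi.single_apply, eq_comm]
  have c_sum : ∀ w, ∑ i, c w i • V i = w := by
    intro w
    have := bV.sum_repr w
    simpa [c, bV_apply] using this
  have c_eq_zero : ∀ w, (∀ i, c w i = 0) → w = 0 := by
    intro w h
    rw [← c_sum w]
    exact Finset.sum_eq_zero fun i _ => by simp [h i]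
  -- integrality: `c (cast z) i * D ∈ ℤ` for `D = |det(v)|`
  set Mz : Matrix (Fin q) (Fin q) ℤ := Matrix.of fun i k => v k i with hMz
  set M : Matrix (Fin q) (Fin q) ℝ := Matrix.of fun i k => V k i with hM
  have hMmap : (Int.castRingHom ℝ).mapMatrix Mz = M := by
    ext i k; simp [hMz, hM, hV]
  have hcolM : M.col = V := by ext k i; simp [hM, Matrix.col]
  have hMunit : IsUnit M := Matrix.linearIndependent_cols_iff_isUnit.mp (hcolM ▸ hli)
  have hdetM : M.det ≠ 0 := ((Matrix.isUnit_iff_isUnit_det _).mp hMunit).ne_zero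
  have hdetMz : Mz.det ≠ 0 := by
    intro h
    apply hdetM
    rw [← hMmap, ← RingHom.map_det, h, map_zero]
  have hdetcast : ((Mz.det : ℤ) : ℝ) = M.det := by
    rw [← hMmap, ← RingHom.map_det]; rfl
  have hmulVec : ∀ w, M *ᵥ (c w) = w := by
    intro w
    conv_rhs => rw [← c_sum w]
    ext i
    simp [hM, Matrix.mulVec, dotProduct, Finset.sum_apply, mul_comm]
  have hcramer : ∀ w i, c w i * M.det = (M.updateCol i w).det := by
    intro w i
    have h1 : M.cramer w = M.det • c w := by
      conv_lhs => rw [← hmulVec w]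
      rw [Matrix.cramer_eq_adjugate_mulVec, Matrix.mulVec_mulVec, Matrix.adjugate_mul,
        Matrix.smul_mulVec, Matrix.one_mulVec]
    have := congrFun h1 i
    rw [Matrix.cramer_apply, Pi.smul_apply, smul_eq_mul] at this
    rw [this, mul_comm]
  set D : ℕ := Mz.det.natAbs with hD
  have hDpos : 0 < D := Int.natAbs_pos.mpr hdetMz
  have hint : ∀ (z : Fin q → ℤ) (i : Fin q), ∃ n : ℤ, c (cast z) i * D = n := by
    intro z i
    have h1 : c (cast z) i * M.det = ((Mz.updateCol i z).det : ℝ) := by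
      rw [hcramer]
      have : M.updateCol i (cast z) = (Int.castRingHom ℝ).mapMatrix (Mz.updateCol i z) := by
        ext i' k
        simp only [Matrix.updateCol_apply, hM, hMz, RingHom.mapMatrix_apply, Matrix.map_apply,
          Matrix.of_apply, cast, hV]
        split_ifs <;> simp
      rw [this, ← RingHom.map_det]; rfl
    have hDreal : (D : ℝ) = |(Mz.det : ℝ)| := by
      rw [hD, Nat.cast_natAbs, Int.cast_abs]
    rcases le_or_gt 0 Mz.det with hpos | hneg
    · refine ⟨(Mz.updateCol i z).det, ?_⟩
      rw [hDreal, abs_of_nonneg (by exact_mod_cast hpos), hdetcast, h1]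
    · refine ⟨-(Mz.updateCol i z).det, ?_⟩
      rw [hDreal, abs_of_neg (by exact_mod_cast hneg), hdetcast, mul_neg, h1, Int.cast_neg]
  -- for each `j`: a vector of `ℤ^q ∩ span(v₀..v_j)` with least positive `v_j`-coordinate
  have key : ∀ j : Fin q, ∃ (yj : Fin q → ℤ) (m : ℝ), 0 < m ∧ m ≤ 1 ∧
      (∀ i, j < i → c (cast yj) i = 0) ∧ c (cast yj) j = m ∧
      (∀ i, i < j → 0 ≤ c (cast yj) i ∧ c (cast yj) i ≤ 1) ∧
      (∀ w : Fin q → ℤ, (∀ i, j < i → c (cast w) i = 0) → ∃ t : ℤ, c (cast w) j = t * m) := by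
    intro j
    let S : ℕ → Prop := fun n => 0 < n ∧ ∃ w : Fin q → ℤ, (∀ i, j < i → c (cast w) i = 0) ∧
      c (cast w) j * D = n
    have hSD : S D := by
      refine ⟨hDpos, v j, fun i hi => ?_, ?_⟩
      · rw [cast_v, c_V]; simp [(ne_of_gt hi)]
      · rw [cast_v, c_V]; simp
    have hS : ∃ n, S n := ⟨D, hSD⟩
    set n₀ := Nat.find hS with hn₀
    obtain ⟨hn₀pos, w₀, hw₀Λ, hw₀⟩ : S n₀ := Nat.find_spec hS
    have hn₀D : n₀ ≤ D := Nat.find_min' hS hSD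
    set m : ℝ := (n₀ : ℝ) / D with hm
    have hDr : (0 : ℝ) < D := by exact_mod_cast hDpos
    have hm0 : 0 < m := div_pos (by exact_mod_cast hn₀pos) hDr
    have hm1 : m ≤ 1 := (div_le_one hDr).mpr (by exact_mod_cast hn₀D)
    have hcw₀ : c (cast w₀) j = m := by
      rw [hm, eq_div_iff hDr.ne']; exact hw₀
    -- divisibility of top coordinates by `m`
    have hdiv : ∀ w : Fin q → ℤ, (∀ i, j < i → c (cast w) i = 0) →
        ∃ t : ℤ, c (cast w) j = t * m := by
      intro w hw
      obtain ⟨a, ha⟩ := hint w j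
      set t : ℤ := a / n₀ with ht
      refine ⟨t, ?_⟩
      -- the remainder vector
      set r : ℤ := a % n₀ with hr
      have hr0 : 0 ≤ r := Int.emod_nonneg _ (by exact_mod_cast hn₀pos.ne')
      have hrlt : r < n₀ := Int.emod_lt_of_pos _ (by exact_mod_cast hn₀pos)
      have hdecomp : a = n₀ * t + r := by
        rw [hr, ht]; have := Int.emod_add_mul_ediv a n₀; linarith
      set w' : Fin q → ℤ := w - t • w₀ with hw'
      have hcw' : ∀ i, c (cast w') i = c (cast w) i - (t : ℝ) * c (cast w₀) i := by
        intro i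
        rw [hw', cast_sub, cast_zsmul, c_sub, c_smul]
        simp
      have hw'Λ : ∀ i, j < i → c (cast w') i = 0 := by
        intro i hi; rw [hcw' i, hw i hi, hw₀Λ i hi]; ring
      have hw'j : c (cast w') j * D = r := by
        rw [hcw' j, sub_mul, ha, mul_assoc, hw₀, hdecomp]
        push_cast; ring
      have hr_zero : r = 0 := by
        by_contra hrne
        have hrpos : 0 < r := lt_of_le_of_ne hr0 (Ne.symm hrne)
        have hSr : S r.toNat := by
          refine ⟨by omega, w', hw'Λ, ?_⟩
          rw [hw'j]
          have : ((r.toNat : ℕ) : ℤ) = r := Int.toNat_of_nonneg hr0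
          exact_mod_cast this.symm
        have hmin := Nat.find_min' hS hSr
        rw [← hn₀] at hmin
        have : (n₀ : ℤ) ≤ r.toNat := by exact_mod_cast hmin
        rw [Int.toNat_of_nonneg hr0] at this
        omega
      have hcwj : c (cast w) j * D = (t : ℝ) * n₀ := by
        rw [ha, hdecomp, hr_zero]; push_cast; ring
      rw [hm]
      field_simp
      rw [hcwj]
    -- coordinates of finite combinations of the `V i`
    have c_zero : c 0 = 0 := by ext i; simp [c]
    have c_combo : ∀ (s : Finset (Fin q)) (t : Fin q → ℝ) (i' : Fin q),
        c (∑ i ∈ s, t i • V i) i' = ∑ i ∈ s, t i * (if i' = i then 1 else 0) := by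
      intro s t i'
      induction s using Finset.induction_on with
      | empty => simp [c_zero]
      | insert a s ha ih =>
        rw [Finset.sum_insert ha, Finset.sum_insert ha, c_add, Pi.add_apply, ih, c_smul,
          Pi.smul_apply, smul_eq_mul, c_V, Pi.single_apply]
    -- the reduced vector
    let yj : Fin q → ℤ := w₀ - ∑ i ∈ Finset.univ.filter (fun i => i < j), ⌊c (cast w₀) i⌋ • v i
    have hcyj : ∀ i', c (cast yj) i' =
        c (cast w₀) i' - if i' < j then (⌊c (cast w₀) i'⌋ : ℝ) else 0 := by
      intro i'
      have hcast_sum : cast (∑ i ∈ Finset.univ.filter (fun i => i < j), ⌊c (cast w₀) i⌋ • v i) =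
          ∑ i ∈ Finset.univ.filter (fun i => i < j), (⌊c (cast w₀) i⌋ : ℝ) • V i := by
        ext k
        simp [cast, hV, Finset.sum_apply]
      simp only [yj]
      rw [cast_sub, c_sub, hcast_sum, Pi.sub_apply, c_combo, Finset.sum_mul_boole]
      simp
    refine ⟨yj, m, hm0, hm1, ?_, ?_, ?_, hdiv⟩
    · intro i hi
      rw [hcyj, hw₀Λ i hi, if_neg (not_lt.mpr hi.le)]; simp
    · rw [hcyj, if_neg (lt_irrefl j), hcw₀]; simp
    · intro i hi
      rw [hcyj, if_pos hi]
      constructor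
      · linarith [Int.floor_le (c (cast w₀) i)]
      · linarith [Int.lt_floor_add_one (c (cast w₀) i)]
  choose y m hm0 hm1 hyΛ hyj hyfrac hdiv using key
  refine ⟨y, ?_, ?_, ?_⟩
  · -- generation
    have gen : ∀ n : ℕ, n ≤ q → ∀ w : Fin q → ℤ, (∀ i : Fin q, n ≤ i.val → c (cast w) i = 0) →
        w ∈ Submodule.span ℤ (Set.range y) := by
      intro n
      induction n with
      | zero =>
        intro _ w hw
        have : w = 0 := cast_inj w 0 (by
          rw [show cast 0 = 0 from by ext i; simp [cast]]
          exact c_eq_zero _ fun i => hw i (Nat.zero_le _))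
        rw [this]; exact Submodule.zero_mem _
      | succ n ih =>
        intro hn w hw
        let jn : Fin q := ⟨n, by omega⟩
        have hwΛ : ∀ i, jn < i → c (cast w) i = 0 :=
          fun i hi => hw i (by exact Nat.succ_le_of_lt (Fin.lt_def.mp hi))
        obtain ⟨t, ht⟩ := hdiv jn w hwΛ
        set w' := w - t • y jn with hw'
        have hw'mem : w' ∈ Submodule.span ℤ (Set.range y) := by
          refine ih (by omega) w' fun i hi => ?_
          rw [hw', cast_sub, cast_zsmul, c_sub, c_smul, Pi.sub_apply, Pi.smul_apply, smul_eq_mul]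
          rcases (show n ≤ i.val from hi).lt_or_eq with hlt | heq
          · have hi' : jn < i := Fin.lt_def.mpr hlt
            rw [hwΛ i hi', hyΛ jn i hi']; ring
          · have : i = jn := Fin.ext heq.symm
            subst this
            rw [ht, hyj]; ring
        have : w = w' + t • y jn := by rw [hw']; abel
        rw [this]
        exact Submodule.add_mem _ hw'mem
          (Submodule.smul_mem _ _ (Submodule.subset_span ⟨jn, rfl⟩))
    refine Submodule.eq_top_iff'.mpr fun w => gen q le_rfl w fun i hi => absurd i.2 (by omega)
  · -- non-vanishing
    intro j hzero
    have h1 := hyj j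
    have : c (cast (y j)) j = 0 := by
      rw [hzero, show cast 0 = 0 from by ext i; simp [cast]]; simp [c]
    rw [this] at h1
    exact (hm0 j).ne' h1.symm
  · -- norm bound
    intro j
    have hsum := c_sum (cast (y j))
    show N (cast (y j)) ≤ ((j : ℕ) + 1) * N (V j)
    rw [← hsum]
    calc N (∑ i, c (cast (y j)) i • V i)
        ≤ ∑ i, N (c (cast (y j)) i • V i) :=
          Finset.le_sum_of_subadditive N (map_zero N).le (fun a b => map_add_le_add N a b) _ _
      _ = ∑ i, |c (cast (y j)) i| * N (V i) := by
          refine Finset.sum_congr rfl fun i _ => ?_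
          rw [map_smul_eq_mul, Real.norm_eq_abs]
      _ ≤ ∑ i : Fin q, if i ≤ j then N (V j) else 0 := by
          refine Finset.sum_le_sum fun i _ => ?_
          rcases lt_trichotomy i j with hlt | heq | hgt
          · rw [if_pos hlt.le]
            have h1 := hyfrac j i hlt
            have h2 : N (V i) ≤ N (V j) := hmono hlt.le
            calc |c (cast (y j)) i| * N (V i) ≤ 1 * N (V i) := by
                  refine mul_le_mul_of_nonneg_right ?_ (apply_nonneg _ _)
                  rw [abs_le]; constructor <;> linarith [h1.1, h1.2]
              _ ≤ N (V j) := by rw [one_mul]; exact h2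
          · subst heq
            rw [if_pos le_rfl, hyj, abs_of_pos (hm0 i)]
            calc m i * N (V i) ≤ 1 * N (V i) :=
                  mul_le_mul_of_nonneg_right (hm1 i) (apply_nonneg _ _)
              _ = N (V i) := one_mul _
          · rw [if_neg (not_le.mpr hgt), hyΛ j i hgt, abs_zero, zero_mul]
      _ = ((j : ℕ) + 1) * N (V j) := by
          rw [Finset.sum_ite, Finset.sum_const_zero, add_zero, Finset.sum_const, nsmul_eq_mul]
          congr 1
          have : (Finset.univ.filter fun i : Fin q => i ≤ j) = Finset.Iic j := by
            ext i; simp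
          rw [this, Fin.card_Iic]
          push_cast
          ring

/-! ### Lemma 4.3.7 (simplified) -/

/-- **Evertse–Győry, Lemma 4.3.7** (p. 72), in the simplified form used here. Let `N` be a
seminorm on `ℝ^q`, `y₀, …, y_{q−1}` non-zero integer vectors generating `ℤ^q` such that `y_{j₀}`
is a shortest non-zero integer vector (`0 < N(y_{j₀}) ≤ N(z)` for all `z ∈ ℤ^q ∖ {0}`), and let
`(aᵢ)_{i ∈ κ}` be non-zero integer vectors generating `ℤ^q` with `∏ N(aᵢ)` minimal among all such
`κ`-indexed systems. Then for any `q` distinct indices `i₁, …, i_q`,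
`N(a_{i₁}) ⋯ N(a_{i_q}) ≤ N(y₀) ⋯ N(y_{q−1})`: compare with the system consisting of the `y_j`
(placed at the `i_k`) and copies of `y_{j₀}` elsewhere, and use `N(aᵢ) ≥ N(y_{j₀})`.
[cite: EvertseGyory2015, Lemma 4.3.7 (p. 72)] -/
theorem prod_seminorm_le_of_minimal (N : Seminorm ℝ (Fin q → ℝ)) (y : Fin q → Fin q → ℤ)
    (hygen : Submodule.span ℤ (Set.range y) = ⊤) (hyne : ∀ j, y j ≠ 0) (j₀ : Fin q)
    (hy0 : ∀ z : Fin q → ℤ, z ≠ 0 → N (fun i => (y j₀ i : ℝ)) ≤ N (fun i => (z i : ℝ)))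
    (hy0pos : 0 < N (fun i => (y j₀ i : ℝ)))
    {κ : Type*} [Fintype κ] (a : κ → Fin q → ℤ) (ha : ∀ i, a i ≠ 0)
    (hmin : ∀ a' : κ → Fin q → ℤ, (∀ i, a' i ≠ 0) → Submodule.span ℤ (Set.range a') = ⊤ →
      ∏ i, N (fun k => (a i k : ℝ)) ≤ ∏ i, N (fun k => (a' i k : ℝ)))
    (e : Fin q → κ) (he : Function.Injective e) :
    ∏ k, N (fun i => (a (e k) i : ℝ)) ≤ ∏ j, N (fun i => (y j i : ℝ)) := by
  classical
  let σ := Equiv.ofInjective e he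
  let a' : κ → Fin q → ℤ := fun i => if h : i ∈ Set.range e then y (σ.symm ⟨i, h⟩) else y j₀
  have ha'e : ∀ k, a' (e k) = y k := by
    intro k
    simp only [a', Set.mem_range_self, dif_pos]
    congr 1
    exact Equiv.ofInjective_symm_apply he k
  have ha'c : ∀ i, i ∉ Set.range e → a' i = y j₀ := by
    intro i hi
    simp only [a', hi, dif_neg, not_false_eq_true]
  have ha'ne : ∀ i, a' i ≠ 0 := by
    intro i
    by_cases hi : i ∈ Set.range e
    · obtain ⟨k, rfl⟩ := hi
      rw [ha'e]; exact hyne k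
    · rw [ha'c i hi]; exact hyne j₀
  have ha'gen : Submodule.span ℤ (Set.range a') = ⊤ := by
    apply top_unique
    rw [← hygen]
    refine Submodule.span_mono ?_
    rintro _ ⟨k, rfl⟩
    exact ⟨e k, ha'e k⟩
  have hle := hmin a' ha'ne ha'gen
  -- split the products over `range e` and its complement
  let C : Finset κ := Finset.univ.filter fun i => i ∉ Set.range e
  have hsplit : ∀ φ : κ → ℝ, ∏ i, φ i = (∏ k, φ (e k)) * ∏ i ∈ C, φ i := by
    intro φ
    rw [← Finset.prod_filter_mul_prod_filter_not Finset.univ (fun i => i ∈ Set.range e)]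
    congr 1
    have himg : Finset.univ.filter (fun i => i ∈ Set.range e) = Finset.univ.image e := by
      ext i; simp
    rw [himg, Finset.prod_image fun a _ b _ h => he h]
  have hL : (∏ k, N (fun i => (a (e k) i : ℝ))) * N (fun i => (y j₀ i : ℝ)) ^ C.card ≤
      ∏ i, N (fun k => (a i k : ℝ)) := by
    rw [hsplit (fun i => N (fun k => (a i k : ℝ))), ← Finset.prod_const]
    refine mul_le_mul_of_nonneg_left ?_ (Finset.prod_nonneg fun k _ => apply_nonneg _ _)
    exact Finset.prod_le_prod (fun i _ => (apply_nonneg _ _)) fun i _ => hy0 (a i) (ha i)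
  have hR : ∏ i, N (fun k => (a' i k : ℝ)) =
      (∏ j, N (fun i => (y j i : ℝ))) * N (fun i => (y j₀ i : ℝ)) ^ C.card := by
    rw [hsplit (fun i => N (fun k => (a' i k : ℝ))), ← Finset.prod_const]
    congr 1
    · exact Finset.prod_congr rfl fun k _ => by rw [ha'e]
    · refine Finset.prod_congr rfl fun i hi => ?_
      rw [ha'c i (by simpa [C] using hi)]
  have hpow : 0 < N (fun i => (y j₀ i : ℝ)) ^ C.card := pow_pos hy0pos _
  exact le_of_mul_le_mul_right (hL.trans (hle.trans_eq hR)) hpow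

/-! ### Proposition 4.3.4 for `ℤ^q` -/

/-- **Evertse–Győry, Proposition 4.3.4** (p. 71), for `V = ℝ^q` and the lattice `L = ℤ^q` (the
case to which the book reduces the general statement on p. 71). Let `N` be a norm on `ℝ^q`
(`q ≥ 1`) with `N(z) ≥ θ > 0` for all `z ∈ ℤ^q ∖ {0}`, let `m ≥ q` (`m = #κ`) and let
`(aᵢ)_{i ∈ κ}` be non-zero vectors of `ℤ^q` generating `ℤ^q` as a `ℤ`-module such that `∏ N(aᵢ)`
is minimal among all such systems of `m` non-zero generators. Then every `x ∈ ℤ^q` can be written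
`x = ∑ bᵢ aᵢ` with `bᵢ ∈ ℤ`, `|bᵢ| ≤ q^{2q} N(x) / θ`. Proof as printed (pp. 72–73): by BFRT
(Lemma 4.3.5) it suffices to bound the `q × q` minors of `(x, (aᵢ))`, which is done with
Lemma 4.3.6, Lemma 4.3.7, Mahler's basis and Minkowski's second theorem:
`(q!/2^q) · V · ∏ N(y_j) ≤ (q!/2^q) · q! · 2^q = (q!)² ≤ q^{2q}`.
[cite: EvertseGyory2015, Prop 4.3.4 (p. 71)] -/
theorem evertseGyory_prop_4_3_4_int (hq : 0 < q) (N : Seminorm ℝ (Fin q → ℝ))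
    (hN : ∀ x, N x = 0 → x = 0) (θ : ℝ) (hθ : 0 < θ)
    (hθN : ∀ z : Fin q → ℤ, z ≠ 0 → θ ≤ N (fun i => (z i : ℝ)))
    {κ : Type*} [Fintype κ] (hκ : q ≤ Fintype.card κ)
    (a : κ → Fin q → ℤ) (ha : ∀ i, a i ≠ 0) (hgen : Submodule.span ℤ (Set.range a) = ⊤)
    (hmin : ∀ a' : κ → Fin q → ℤ, (∀ i, a' i ≠ 0) → Submodule.span ℤ (Set.range a') = ⊤ →
      ∏ i, N (fun k => (a i k : ℝ)) ≤ ∏ i, N (fun k => (a' i k : ℝ)))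
    (x : Fin q → ℤ) :
    ∃ b : κ → ℤ, x = ∑ i, b i • a i ∧
      ∀ i, (|b i| : ℝ) ≤ (q : ℝ) ^ (2 * q) * N (fun k => (x k : ℝ)) / θ := by
  classical
  -- trivial case `x = 0`
  by_cases hx : x = 0
  · refine ⟨0, by simp [hx], fun i => ?_⟩
    simp only [Pi.zero_apply, abs_zero, Int.cast_zero]
    exact div_nonneg (mul_nonneg (by positivity) (apply_nonneg _ _)) hθ.le
  set Nx : ℝ := N (fun k => (x k : ℝ)) with hNx
  have hθNx : θ ≤ Nx := hθN x hx
  have hNxpos : 0 < Nx := hθ.trans_le hθNx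
  have hone : 1 ≤ Nx / θ := by rw [le_div_iff₀ hθ, one_mul]; exact hθNx
  -- Minkowski's second theorem for a directional system, and a Mahler basis
  obtain ⟨v, hli, hmono, hdir, hMink⟩ := exists_directional_system_prod_mul_volume_le hq N hN
  obtain ⟨y, hygen, hyne, hyle⟩ := exists_int_basis_le_of_directional N v hli hmono
  -- the unit ball and its volume
  set B : Set (Fin q → ℝ) := {z | N z ≤ 1} with hB
  have hBfin : volume B < ⊤ := volume_seminormBall_lt_top N hN
  set Vr : ℝ := (volume B).toReal with hVr
  have hBeq : volume B = volume {z : Fin q → ℝ | N z < 1} := by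
    haveI : Nontrivial (Fin q → ℝ) := by
      haveI : Nonempty (Fin q) := ⟨⟨0, hq⟩⟩
      infer_instance
    exact MeasureTheory.measure_le_eq_lt volume (map_zero N) (fun z => map_neg_eq_map N z)
      (fun z w => map_add_le_add N z w) (fun {z} hz => hN z hz)
      (fun r z => (map_smul_eq_mul N r z).le.trans_eq (by rw [Real.norm_eq_abs])) 1
  have hVprod : (∏ k, N (fun i => (v k i : ℝ))) * Vr ≤ 2 ^ q := by
    rw [← hBeq] at hMink
    have h1 := ENNReal.toReal_mono (by simp) hMink
    rw [ENNReal.toReal_mul, ENNReal.toReal_ofReal (Finset.prod_nonneg fun k _ => apply_nonneg _ _)]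
      at h1
    simpa using h1
  -- `Vr * ∏ N(y_j) ≤ q! * 2^q`
  have hyprod : ∏ j, N (fun i => (y j i : ℝ)) ≤
      (q.factorial : ℝ) * ∏ j, N (fun i => (v j i : ℝ)) := by
    calc ∏ j, N (fun i => (y j i : ℝ))
        ≤ ∏ j : Fin q, (((j : ℕ) : ℝ) + 1) * N (fun i => (v j i : ℝ)) :=
          Finset.prod_le_prod (fun j _ => apply_nonneg _ _) fun j _ => hyle j
      _ = (∏ j : Fin q, (((j : ℕ) : ℝ) + 1)) * ∏ j, N (fun i => (v j i : ℝ)) :=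
          Finset.prod_mul_distrib
      _ = (q.factorial : ℝ) * ∏ j, N (fun i => (v j i : ℝ)) := by
          congr 1
          rw [Fin.prod_univ_eq_prod_range (fun j => ((j : ℝ) + 1)) q]
          exact_mod_cast Finset.prod_range_add_one_eq_factorial q
  have hVy : Vr * ∏ j, N (fun i => (y j i : ℝ)) ≤ (q.factorial : ℝ) * 2 ^ q := by
    have hVr0 : 0 ≤ Vr := ENNReal.toReal_nonneg
    calc Vr * ∏ j, N (fun i => (y j i : ℝ))
        ≤ Vr * ((q.factorial : ℝ) * ∏ j, N (fun i => (v j i : ℝ))) :=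
          mul_le_mul_of_nonneg_left hyprod hVr0
      _ = (q.factorial : ℝ) * ((∏ k, N (fun i => (v k i : ℝ))) * Vr) := by ring
      _ ≤ (q.factorial : ℝ) * 2 ^ q := mul_le_mul_of_nonneg_left hVprod (by positivity)
  -- `y₀` is a shortest vector
  let j₀ : Fin q := ⟨0, hq⟩
  have hv0 : ∀ z : Fin q → ℤ, z ≠ 0 → N (fun i => (v j₀ i : ℝ)) ≤ N (fun i => (z i : ℝ)) := by
    intro z hz
    by_contra hlt
    push Not at hlt
    have hmem := hdir j₀ z hlt
    have hempty : {l : Fin q | l < j₀} = ∅ := by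
      ext l; simp [j₀, Fin.lt_def]
    rw [hempty, Set.image_empty, Submodule.span_empty, Submodule.mem_bot] at hmem
    apply hz
    ext i
    have := congrFun hmem i
    simp only [Pi.zero_apply] at this
    exact_mod_cast this
  have hy0 : ∀ z : Fin q → ℤ, z ≠ 0 → N (fun i => (y j₀ i : ℝ)) ≤ N (fun i => (z i : ℝ)) := by
    intro z hz
    have := hyle j₀
    simp only [j₀, Nat.cast_zero, zero_add, one_mul] at this
    exact this.trans (hv0 z hz)
  have hy0pos : 0 < N (fun i => (y j₀ i : ℝ)) := by
    refine (apply_nonneg N _).lt_of_ne fun h => hyne j₀ ?_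
    have := congrFun (hN _ h.symm)
    ext i
    have hi := this i
    simp only [Pi.zero_apply] at hi
    exact_mod_cast hi
  -- the constant
  have hfact : ((q.factorial : ℝ) / 2 ^ q) * ((q.factorial : ℝ) * 2 ^ q) ≤ (q : ℝ) ^ (2 * q) := by
    have h1 : ((q.factorial : ℝ) / 2 ^ q) * ((q.factorial : ℝ) * 2 ^ q) =
        (q.factorial : ℝ) * q.factorial := by
      field_simp
    rw [h1, two_mul, pow_add]
    have : (q.factorial : ℝ) ≤ (q : ℝ) ^ q := by exact_mod_cast Nat.factorial_le_pow q
    exact mul_le_mul this this (by positivity) (by positivity)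
  -- bound on all `q × q` minors of `(x, (aᵢ))`
  set R : ℝ := (q : ℝ) ^ (2 * q) * Nx / θ with hR
  have hminors : ∀ e : Fin q → Option κ, Function.Injective e →
      |(((Matrix.of fun i k => (e k).elim x a i).det : ℤ) : ℝ)| ≤ R := by
    intro e he
    -- the columns as real vectors
    let f : Fin q → Fin q → ℝ := fun k i => ((e k).elim x a i : ℝ)
    have hdetf : (((Matrix.of fun i k => (e k).elim x a i).det : ℤ) : ℝ) = (Matrix.of f).det := by
      rw [show (((Matrix.of fun i k => (e k).elim x a i).det : ℤ) : ℝ) =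
          (Int.castRingHom ℝ) (Matrix.of fun i k => (e k).elim x a i).det from rfl,
        RingHom.map_det, ← Matrix.det_transpose]
      congr 1
    rw [hdetf]
    have h436 := abs_det_le_of_seminorm hq N hN f
    have hVr0 : 0 ≤ Vr := ENNReal.toReal_nonneg
    by_cases hnone : ∀ k, e k ≠ none
    · -- all columns among the `aᵢ`
      let g : Fin q → κ := fun k => (e k).get (Option.ne_none_iff_isSome.mp (hnone k))
      have hg : ∀ k, e k = some (g k) := fun k => by simp [g]
      have hginj : Function.Injective g := by
        intro k k' h
        apply he
        rw [hg k, hg k', h]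
      have hf : ∀ k, f k = fun i => (a (g k) i : ℝ) := by
        intro k; funext i; simp [f, hg k]
      have h437 := prod_seminorm_le_of_minimal N y hygen hyne j₀ hy0 hy0pos a ha hmin g hginj
      calc |(Matrix.of f).det|
          ≤ (q.factorial : ℝ) / 2 ^ q * Vr * ∏ k, N (f k) := h436
        _ = (q.factorial : ℝ) / 2 ^ q * (Vr * ∏ k, N (fun i => (a (g k) i : ℝ))) := by
            rw [mul_assoc]; congr 2; exact Finset.prod_congr rfl fun k _ => by rw [hf]
        _ ≤ (q.factorial : ℝ) / 2 ^ q * (Vr * ∏ j, N (fun i => (y j i : ℝ))) := by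
            gcongr
        _ ≤ (q.factorial : ℝ) / 2 ^ q * ((q.factorial : ℝ) * 2 ^ q) := by gcongr
        _ ≤ (q : ℝ) ^ (2 * q) := hfact
        _ ≤ (q : ℝ) ^ (2 * q) * (Nx / θ) := le_mul_of_one_le_right (by positivity) hone
        _ = R := by rw [hR, mul_div_assoc]
    · -- the column `x` occurs, at the index `k₀`
      push Not at hnone
      obtain ⟨k₀, hk₀⟩ := hnone
      have hk : ∀ k, k ≠ k₀ → e k ≠ none := fun k hk h => hk (he (h.trans hk₀.symm))
      -- an index `i₁ ∈ κ` not among the columns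
      let U : Finset κ := Finset.univ.filter fun i => some i ∈ Set.range e
      have hUcard : U.card ≤ q - 1 := by
        have h1 : U.card ≤ ((Finset.univ.image e).erase none).card := by
          refine Finset.card_le_card_of_injOn some (fun i hi => ?_) (Option.some_injective κ).injOn
          simp only [U, Finset.coe_filter, Finset.mem_univ, true_and, Set.mem_setOf_eq] at hi
          obtain ⟨k, hk'⟩ := hi
          simp only [Finset.coe_erase, Set.mem_sdiff, Finset.coe_image, Finset.coe_univ,
            Set.image_univ, Set.mem_range, Set.mem_singleton_iff]
          exact ⟨⟨k, hk'⟩, Option.some_ne_none _⟩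
        have h2 : ((Finset.univ.image e).erase none).card = q - 1 := by
          rw [Finset.card_erase_of_mem (Finset.mem_image.mpr ⟨k₀, Finset.mem_univ _, hk₀⟩),
            Finset.card_image_of_injective _ he, Finset.card_univ, Fintype.card_fin]
        omega
      have hU : ∃ i₁, i₁ ∉ U := by
        by_contra h
        push Not at h
        have : U = Finset.univ := Finset.eq_univ_iff_forall.mpr h
        rw [this, Finset.card_univ] at hUcard
        omega
      obtain ⟨i₁, hi₁⟩ := hU
      have hi₁' : ∀ k, e k ≠ some i₁ := by
        intro k hk'
        apply hi₁
        simp only [U, Finset.mem_filter, Finset.mem_univ, true_and]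
        exact ⟨k, hk'⟩
      let g : Fin q → κ := fun k =>
        if h : e k = none then i₁ else (e k).get (Option.ne_none_iff_isSome.mp h)
      have hgk₀ : g k₀ = i₁ := by simp [g, hk₀]
      have hg : ∀ k, k ≠ k₀ → e k = some (g k) := by
        intro k hkk
        simp [g, hk k hkk]
      have hginj : Function.Injective g := by
        intro k k' h
        by_cases h1 : k = k₀ <;> by_cases h2 : k' = k₀
        · rw [h1, h2]
        · exfalso
          rw [h1, hgk₀] at h
          exact hi₁' k' (by rw [hg k' h2, ← h])
        · exfalso
          rw [h2, hgk₀] at h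
          exact hi₁' k (by rw [hg k h1, h])
        · apply he
          rw [hg k h1, hg k' h2, h]
      have hfk₀ : f k₀ = fun i => (x i : ℝ) := by funext i; simp [f, hk₀]
      have hf : ∀ k, k ≠ k₀ → f k = fun i => (a (g k) i : ℝ) := by
        intro k hkk; funext i; simp [f, hg k hkk]
      have h437 := prod_seminorm_le_of_minimal N y hygen hyne j₀ hy0 hy0pos a ha hmin g hginj
      set P' : ℝ := ∏ k ∈ Finset.univ.erase k₀, N (fun i => (a (g k) i : ℝ)) with hP'
      have hP'0 : 0 ≤ P' := Finset.prod_nonneg fun k _ => apply_nonneg _ _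
      have hprodf : ∏ k, N (f k) = Nx * P' := by
        rw [← Finset.mul_prod_erase Finset.univ _ (Finset.mem_univ k₀), hfk₀, hP']
        congr 1
        exact Finset.prod_congr rfl fun k hk => by rw [hf k (Finset.ne_of_mem_erase hk)]
      have hprodg : ∏ k, N (fun i => (a (g k) i : ℝ)) = N (fun i => (a i₁ i : ℝ)) * P' := by
        rw [← Finset.mul_prod_erase Finset.univ _ (Finset.mem_univ k₀), hgk₀]
      have hP'le : θ * P' ≤ ∏ j, N (fun i => (y j i : ℝ)) := by
        calc θ * P' ≤ N (fun i => (a i₁ i : ℝ)) * P' :=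
              mul_le_mul_of_nonneg_right (hθN _ (ha i₁)) hP'0
          _ = ∏ k, N (fun i => (a (g k) i : ℝ)) := hprodg.symm
          _ ≤ _ := h437
      have hP'le' : P' ≤ (∏ j, N (fun i => (y j i : ℝ))) / θ := by
        rw [le_div_iff₀ hθ, mul_comm]; exact hP'le
      calc |(Matrix.of f).det|
          ≤ (q.factorial : ℝ) / 2 ^ q * Vr * ∏ k, N (f k) := h436
        _ = (q.factorial : ℝ) / 2 ^ q * (Vr * P') * Nx := by rw [hprodf]; ring
        _ ≤ (q.factorial : ℝ) / 2 ^ q * (Vr * ((∏ j, N (fun i => (y j i : ℝ))) / θ)) * Nx := by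
            gcongr
        _ = (q.factorial : ℝ) / 2 ^ q * (Vr * ∏ j, N (fun i => (y j i : ℝ))) * (Nx / θ) := by
            ring
        _ ≤ (q.factorial : ℝ) / 2 ^ q * ((q.factorial : ℝ) * 2 ^ q) * (Nx / θ) := by gcongr
        _ ≤ (q : ℝ) ^ (2 * q) * (Nx / θ) :=
            mul_le_mul_of_nonneg_right hfact (by positivity)
        _ = R := by rw [hR, mul_div_assoc]
  -- BFRT
  obtain ⟨b, hb, hbR⟩ := bfrt_exists_small_solution a hgen x R hminors
  exact ⟨b, hb, hbR⟩

/-! ### Proposition 4.3.4 for a lattice of integer vectors in `ℝ^P` -/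

/-- **Evertse–Győry, Proposition 4.3.4**, for a lattice `L ⊆ ℤ^P ⊂ ℝ^P` spanned by integer
vectors `(aᵢ)_{i ∈ κ}` (the form used in the proof of Proposition 4.4.1, where `L` is the image of
a finitely generated subgroup of `ℚ*` under `y ↦ (ord_p y)_p`), with the exponent bound stated
through `m = #κ ≥ rank L`: let `N` be a norm on `ℝ^P` with `N ≥ θ > 0` on `L ∖ {0}`, and let the
`aᵢ` be non-zero with `∏ N(aᵢ)` minimal among all `κ`-indexed systems of non-zero vectors of `L`
generating `L`; then every `x ∈ L` is `∑ bᵢ aᵢ` with `|bᵢ| ≤ m^{2m} N(x)/θ`. Reduction to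
`evertseGyory_prop_4_3_4_int`: `L` is free of rank `r ≤ m` with a `ℤ`-basis of integer vectors,
which is `ℝ`-linearly independent (`linearIndependent_algebraMap_comp_iff`), so coordinates
identify `(L, N)` with `(ℤ^r, N ∘ Φ)`; finally `r^{2r} ≤ m^{2m}`.
[cite: EvertseGyory2015, Prop 4.3.4 (p. 71)] -/
theorem exists_repr_le_of_minimal {P : Type*} [Fintype P]
    (N : Seminorm ℝ (P → ℝ)) (hN : ∀ x, N x = 0 → x = 0) (θ : ℝ) (hθ : 0 < θ)
    {κ : Type*} [Fintype κ] (a : κ → P → ℝ) (haint : ∀ i p, ∃ n : ℤ, a i p = n)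
    (ha : ∀ i, a i ≠ 0)
    (hθL : ∀ w ∈ Submodule.span ℤ (Set.range a), w ≠ 0 → θ ≤ N w)
    (hmin : ∀ a' : κ → P → ℝ, (∀ i, a' i ∈ Submodule.span ℤ (Set.range a) ∧ a' i ≠ 0) →
      Submodule.span ℤ (Set.range a') = Submodule.span ℤ (Set.range a) →
      ∏ i, N (a i) ≤ ∏ i, N (a' i))
    (x : P → ℝ) (hx : x ∈ Submodule.span ℤ (Set.range a)) :
    ∃ b : κ → ℤ, x = ∑ i, b i • a i ∧
      ∀ i, (|b i| : ℝ) ≤ (Fintype.card κ : ℝ) ^ (2 * Fintype.card κ) * N x / θ := by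
  classical
  set L : Submodule ℤ (P → ℝ) := Submodule.span ℤ (Set.range a) with hL
  -- empty index type
  rcases isEmpty_or_nonempty κ with hκ | hκ
  · have hL0 : L = ⊥ := by
      rw [hL, Set.range_eq_empty a, Submodule.span_empty]
    have hx0 : x = 0 := by rw [hL0, Submodule.mem_bot] at hx; exact hx
    exact ⟨fun _ => 0, by simp [hx0], fun i => (hκ.false i).elim⟩
  obtain ⟨i₀⟩ := hκ
  -- elements of `L` are integer vectors
  have hLint : ∀ w ∈ L, ∃ z : P → ℤ, w = fun p => (z p : ℝ) := by
    intro w hw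
    induction hw using Submodule.span_induction with
    | mem w hw =>
      obtain ⟨i, rfl⟩ := hw
      choose n hn using haint i
      exact ⟨n, funext hn⟩
    | zero => exact ⟨0, by ext; simp⟩
    | add u w _ _ hu hw =>
      obtain ⟨zu, rfl⟩ := hu
      obtain ⟨zw, rfl⟩ := hw
      exact ⟨zu + zw, by ext; simp⟩
    | smul t w _ hw =>
      obtain ⟨z, rfl⟩ := hw
      exact ⟨t • z, by ext; simp⟩
  -- `L` is finite free over `ℤ`; a basis
  haveI : Module.Finite ℤ L := Module.Finite.span_of_finite ℤ (Set.finite_range a)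
  haveI : Module.Free ℤ L := Module.free_of_finite_type_torsion_free'
  set r : ℕ := finrank ℤ L with hr
  let bL : Basis (Fin r) ℤ L := Module.finBasis ℤ L
  have hu : ∀ k, ∃ z : P → ℤ, ((bL k : L) : P → ℝ) = fun p => (z p : ℝ) :=
    fun k => hLint _ (bL k).2
  choose u hu using hu
  -- the basis vectors are `ℝ`-linearly independent
  have hliZ : LinearIndependent ℤ u := by
    have h1 : LinearIndependent ℤ (fun k => ((bL k : L) : P → ℝ)) :=
      bL.linearIndependent.map' L.subtype (Submodule.ker_subtype L)
    let castL : (P → ℤ) →ₗ[ℤ] (P → ℝ) := ((Int.castAddHom ℝ).compLeft P).toIntLinearMap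
    have h2 : (fun k => ((bL k : L) : P → ℝ)) = castL ∘ u := by
      funext k; rw [hu k]; rfl
    rw [h2] at h1
    exact LinearIndependent.of_comp castL h1
  set W : Fin r → P → ℝ := fun k p => (u k p : ℝ) with hW
  have hWb : ∀ k, W k = ((bL k : L) : P → ℝ) := fun k => (hu k).symm
  have hliR : LinearIndependent ℝ W := by
    have := (linearIndependent_algebraMap_comp_iff (R := ℤ) (S := ℝ) (v := u)).mpr hliZ
    have hWeq : (fun i => ⇑(algebraMap ℤ ℝ) ∘ u i) = W := by
      funext k p; simp [hW]
    rw [hWeq] at this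
    exact this
  -- the linear map `Φ : ℝ^r → ℝ^P`, `e_k ↦ W k`
  let Φ : (Fin r → ℝ) →ₗ[ℝ] (P → ℝ) := Fintype.linearCombination ℝ W
  have Φ_apply : ∀ c, Φ c = ∑ k, c k • W k := fun c => by
    simp only [Φ, Fintype.linearCombination_apply]
  have Φ_inj : Function.Injective Φ := by
    intro c c' h
    have h0 : Φ (c - c') = 0 := by rw [map_sub, h, sub_self]
    rw [Φ_apply] at h0
    have := Fintype.linearIndependent_iff.mp hliR (c - c') h0
    funext k
    exact sub_eq_zero.mp (this k)
  -- integer coordinate vectors and `Φ`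
  let cast : (Fin r → ℤ) → (Fin r → ℝ) := fun z k => (z k : ℝ)
  have Φ_cast : ∀ z : Fin r → ℤ, Φ (cast z) = ((bL.equivFun.symm z : L) : P → ℝ) := by
    intro z
    rw [Φ_apply, Basis.equivFun_symm_apply, Submodule.coe_sum]
    refine Finset.sum_congr rfl fun k _ => ?_
    rw [Submodule.coe_smul, ← hWb k]
    simp [cast, Int.cast_smul_eq_zsmul]
  have cast_inj : ∀ z z' : Fin r → ℤ, cast z = cast z' → z = z' := by
    intro z z' h; funext k
    have := congrFun h k
    simp only [cast] at this
    exact_mod_cast this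
  -- the transported norm
  let N' : Seminorm ℝ (Fin r → ℝ) := N.comp Φ
  have N'_apply : ∀ c, N' c = N (Φ c) := fun c => rfl
  have hN' : ∀ c, N' c = 0 → c = 0 := by
    intro c hc
    rw [N'_apply] at hc
    exact Φ_inj ((hN _ hc).trans (map_zero Φ).symm)
  -- coordinates of the generators and of `x`
  let A : κ → Fin r → ℤ := fun i => bL.equivFun ⟨a i, Submodule.subset_span ⟨i, rfl⟩⟩
  have hA : ∀ i, Φ (cast (A i)) = a i := by
    intro i; rw [Φ_cast]; simp [A]
  let X : Fin r → ℤ := bL.equivFun ⟨x, hx⟩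
  have hX : Φ (cast X) = x := by rw [Φ_cast]; simp [X]
  -- every `w ∈ L` is `Φ (cast z)`
  have hsurj : ∀ (w : P → ℝ) (hw : w ∈ L), Φ (cast (bL.equivFun ⟨w, hw⟩)) = w := by
    intro w hw; rw [Φ_cast]; simp
  have hAne : ∀ i, A i ≠ 0 := by
    intro i h
    apply ha i
    rw [← hA i, h]
    show Φ (cast 0) = 0
    rw [show cast 0 = 0 from by ext; simp [cast], map_zero]
  -- `A` generates `ℤ^r`
  have hgenA : Submodule.span ℤ (Set.range A) = ⊤ := by
    refine Submodule.eq_top_iff'.mpr fun z => ?_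
    set w : L := bL.equivFun.symm z with hw
    obtain ⟨c, hc⟩ := (Submodule.mem_span_range_iff_exists_fun ℤ).mp
      (show (w : P → ℝ) ∈ Submodule.span ℤ (Set.range a) from w.2)
    have hwL : (w : L) = ∑ i, c i • (⟨a i, Submodule.subset_span ⟨i, rfl⟩⟩ : L) := by
      apply Subtype.ext
      rw [Submodule.coe_sum]
      simp only [Submodule.coe_smul]
      exact hc.symm
    have hz : z = ∑ i, c i • A i := by
      have := congrArg bL.equivFun hwL
      rw [hw, LinearEquiv.apply_symm_apply, map_sum] at this
      rw [this]
      refine Finset.sum_congr rfl fun i _ => ?_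
      rw [map_smul]
    rw [hz]
    exact Submodule.sum_mem _ fun i _ => Submodule.smul_mem _ _ (Submodule.subset_span ⟨i, rfl⟩)
  -- the `θ`-bound for `N'`
  have hθ' : ∀ z : Fin r → ℤ, z ≠ 0 → θ ≤ N' (cast z) := by
    intro z hz
    rw [N'_apply, Φ_cast]
    refine hθL _ (bL.equivFun.symm z).2 fun h => hz ?_
    have : (bL.equivFun.symm z : L) = 0 := Subtype.ext h
    have h2 := congrArg bL.equivFun this
    rwa [LinearEquiv.apply_symm_apply, map_zero] at h2
  -- minimality for `N'`
  have hminA : ∀ A' : κ → Fin r → ℤ, (∀ i, A' i ≠ 0) → Submodule.span ℤ (Set.range A') = ⊤ →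
      ∏ i, N' (cast (A i)) ≤ ∏ i, N' (cast (A' i)) := by
    intro A' hA'ne hA'gen
    let a' : κ → P → ℝ := fun i => Φ (cast (A' i))
    have ha'L : ∀ i, a' i ∈ L := fun i => by
      show Φ (cast (A' i)) ∈ L
      rw [Φ_cast]; exact (bL.equivFun.symm (A' i)).2
    have ha'ne : ∀ i, a' i ≠ 0 := by
      intro i h
      apply hA'ne i
      apply cast_inj
      rw [show cast 0 = 0 from by ext; simp [cast]]
      exact Φ_inj (h.trans (map_zero Φ).symm)
    have ha'span : Submodule.span ℤ (Set.range a') = L := by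
      apply le_antisymm
      · exact Submodule.span_le.mpr (by rintro _ ⟨i, rfl⟩; exact ha'L i)
      · intro w hw
        -- `w = Φ (cast z)` with `z ∈ span (range A') = ⊤`
        set z : Fin r → ℤ := bL.equivFun ⟨w, hw⟩ with hz
        have hwz : w = Φ (cast z) := (hsurj w hw).symm
        have hzmem : z ∈ Submodule.span ℤ (Set.range A') := by rw [hA'gen]; trivial
        obtain ⟨c, hc⟩ := (Submodule.mem_span_range_iff_exists_fun ℤ).mp hzmem
        have hw' : w = ∑ i, c i • a' i := by
          rw [hwz, ← hc]
          have : cast (∑ i, c i • A' i) = ∑ i, (c i : ℝ) • cast (A' i) := by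
            ext k; simp [cast, Finset.sum_apply]
          rw [this, map_sum]
          refine Finset.sum_congr rfl fun i _ => ?_
          rw [map_smul, Int.cast_smul_eq_zsmul]
        rw [hw']
        exact Submodule.sum_mem _ fun i _ =>
          Submodule.smul_mem _ _ (Submodule.subset_span ⟨i, rfl⟩)
    have h := hmin a' (fun i => ⟨ha'L i, ha'ne i⟩) ha'span
    have e1 : ∏ i, N' (cast (A i)) = ∏ i, N (a i) :=
      Finset.prod_congr rfl fun i _ => by rw [N'_apply, hA]
    rw [e1]
    exact h
  -- rank bounds
  obtain ⟨e, he, -⟩ := exists_minor_ne_zero A hgenA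
  have hrm : r ≤ Fintype.card κ := by
    simpa using Fintype.card_le_of_injective e he
  have hr0 : 0 < r := by
    rw [Nat.pos_iff_ne_zero]
    intro h0
    apply hAne i₀
    funext k
    exact (Fin.elim0 (h0 ▸ k : Fin 0))
  -- apply Proposition 4.3.4 on `ℤ^r`
  obtain ⟨b, hb, hble⟩ := evertseGyory_prop_4_3_4_int hr0 N' hN' θ hθ hθ' hrm A hAne hgenA
    hminA X
  refine ⟨b, ?_, fun i => ?_⟩
  · -- `x = ∑ bᵢ aᵢ`
    rw [← hX, hb]
    have : cast (∑ i, b i • A i) = ∑ i, (b i : ℝ) • cast (A i) := by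
      ext k; simp [cast, Finset.sum_apply]
    rw [this, map_sum]
    refine Finset.sum_congr rfl fun i _ => ?_
    rw [map_smul, hA, Int.cast_smul_eq_zsmul]
  · have hNX : N' (cast X) = N x := by rw [N'_apply, hX]
    rw [hNX] at hble
    refine (hble i).trans ?_
    have hNx : 0 ≤ N x := apply_nonneg _ _
    refine div_le_div_of_nonneg_right (mul_le_mul_of_nonneg_right ?_ hNx) hθ.le
    have hm1 : (1 : ℝ) ≤ Fintype.card κ := by exact_mod_cast (hr0.trans_le hrm)
    calc (r : ℝ) ^ (2 * r) ≤ (Fintype.card κ : ℝ) ^ (2 * r) :=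
          pow_le_pow_left₀ (Nat.cast_nonneg _) (by exact_mod_cast hrm) _
      _ ≤ (Fintype.card κ : ℝ) ^ (2 * Fintype.card κ) := pow_le_pow_right₀ hm1 (by omega)

end Literature.NumberTheory.DiophantineGeometry.Dioph

end
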